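import Literature.Computability.Complexity.ArityReduction
import Literature.Computability.Complexity.BCSP
import Literature.Computability.Complexity.DegreeReductionSoundness
import Literature.Computability.Complexity.Expanderize
import Literature.Computability.Complexity.PoweringSoundness
import Literature.Computability.Complexity.TesterQueries
import HarnessLib

/-!
# One round of Dinur's gap amplification (Arora–Barak, Lemma 22.4 "PCP Main Lemma"): the combinatorial map

The composite CL-map `f = h ∘ g_{ℓ,q₀}` of Arora–Barak 2009, §22.2.1 ("Lemmas 22.5 and 22.6 together imply
Lemma 22.4 by setting `f(φ) = h(g_{6,q₀}(φ))`"), where gap amplification `g` is itself "the CL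
reductions mapping arbitrary qCSP instances to 'nice' instances" (§22.A, Claims 22.36–22.38) followed by
powering (Lemma 22.9), assembled from the tree's combinatorial renderings of each step:

`BCSP q₀` (Boolean constraints of arity `q₀ = 864`)
 → `ArityReduction` (Claim 22.36, alphabet `W = 2^{q₀}`)
 → `DegreeReduction` (Claim 22.37, with edge expanders `X k` on the clouds)
 → padding + `Expanderize` + laziness (Claim 22.38, with spectral expanders `XN n` of size `Nx n ≥ n`)
 → powering `ψᵗ` (Lemma 22.9, `PoweringConstruction`/`PoweringSoundness`)
 → `AlphabetReduction` by the Hadamard assignment tester (Lemma 22.6, Cor. 22.13) rendered as `q₀`-ary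
   Boolean constraints (`TesterQueries`) — back in `BCSP q₀`.

* `BCSP q`, `EdgeCSP`, `LazyCSP` — the three instance formats with their `Sat` and `Gap r` ("every
  assignment violates at least an `r`-fraction of the constraints") predicates;
* `arity`, `degree`, `padExp`, `powAlpha` — the four stages as maps between these formats, each with its
  completeness lemma (`Sat → Sat`) and its gap lemma; `round P φ` their composite (identity on instances
  without constraints);
* **`round_length_le`** (linear size: at most `roundC P · m` constraints), **`round_sat`** (completeness),
  **`round_gap`** (soundness): under `P.Good` — degrees `≥ 1`, edge expansion `η > 0` of the `X k`, spectral
  bound `1/10` of the `XN n`, `Nx n ≤ cN · n`, and the powering parameter `t` large enough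
  (`64 W⁴ (2 + 18D) ≤ m_w c₃`) — if every assignment violates an `r`-fraction of `φ` then every assignment
  violates a `min(2r, ε₀ P)`-fraction of `round P φ`, with the explicit constant `ε₀ P > 0`.  This is
  Lemma 22.4: "`val(φ) ≤ 1 - ε ⇒ val(ψ) ≤ 1 - 2ε` for `ε < ε₀`, `|ψ| ≤ C|φ|`, `q₀`-ary binary, and
  satisfiable if `φ` is", at the level of the instances (the polynomial running time of `f` is a
  statement about its machine rendering and is not treated here).

The expander families enter as parameters (`RoundParams`); their existence is a separate matter.

## References

* S. Arora, B. Barak, *Computational Complexity: A Modern Approach*, CUP 2009, Lemma 22.4, §22.2.1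
  (f = h ∘ g), Lemma 22.5, Lemma 22.6, Lemma 22.9, §22.A (Claims 22.36–22.38).
* I. Dinur, *The PCP theorem by gap amplification*, J. ACM 54 (2007), Thm. 1.5 (main theorem).
-/

noncomputable section

-- Definitional unfolding may meet `2 ^ q₀ = 2 ^ 864` (the alphabet size); let `whnf` evaluate it natively
-- instead of unfolding `Nat.pow` (which exceeds the recursion depth).
set_option exponentiation.threshold 4096

namespace Literature.Computability.Complexity

open Finset Literature.Computability.Complexity.LowDegree

namespace Expander

open RotGraph BLR BLR.Table ArityReduction DegreeReduction

/-! ### Instance formats -/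

/-- A binary constraint system on ordered pairs of variables with values in `[W]`: `m` constraints,
constraint `s` on the pair `e s` with relation `R s`. [cite: AroraBarakCC2009, Def. 22.1 (2CSP_W)] -/
structure EdgeCSP where
  /-- number of variables -/
  n : ℕ
  /-- number of constraints -/
  m : ℕ
  /-- alphabet size -/
  W : ℕ
  /-- endpoints of the constraints -/
  e : Fin m → Fin n × Fin n
  /-- relations of the constraints -/
  R : Fin m → ℕ → ℕ → Bool

namespace EdgeCSP

/-- Violated constraints. [cite: AroraBarakCC2009, Def. 22.1] -/
def viol (ψ : EdgeCSP) (σ : Fin ψ.n → ℕ) : ℕ := (univ.filter fun s => ψ.R s (σ (ψ.e s).1) (σ (ψ.e s).2) = false).card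

/-- Satisfiability by values `< W`. [cite: AroraBarakCC2009, Def. 22.1] -/
def Sat (ψ : EdgeCSP) : Prop := ∃ σ : Fin ψ.n → ℕ, (∀ u, σ u < ψ.W) ∧ ∀ s, ψ.R s (σ (ψ.e s).1) (σ (ψ.e s).2) = true

/-- `ψ.Gap r`: every assignment of values `< W` violates at least `r · m` constraints. [cite: AroraBarakCC2009, Def. 22.1] -/
def Gap (ψ : EdgeCSP) (r : ℝ) : Prop := ∀ σ : Fin ψ.n → ℕ, (∀ u, σ u < ψ.W) → r * ψ.m ≤ ψ.viol σ

end EdgeCSP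

/-- A binary constraint system carried by the darts of the LAZY version of a regular rotation graph `G`
(degree `dH`, so `dH + dH` labels), values in `[W]` — the "nice" instances handed to powering.
[cite: AroraBarakCC2009, §22.2.4 (nice instances, Properties 1–3)] -/
structure LazyCSP where
  /-- number of vertices -/
  n : ℕ
  /-- degree of the underlying (non-lazy) graph -/
  dH : ℕ
  /-- alphabet size -/
  W : ℕ
  /-- the underlying graph -/
  G : RotGraph n dH
  /-- dart constraints of `G.lazy` -/
  C : Fin n → Fin (dH + dH) → ℕ → ℕ → Bool

namespace LazyCSP

/-- Violated darts. [cite: AroraBarakCC2009, §22.2.4] -/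
def viol (ψ : LazyCSP) (σ : Fin ψ.n → ℕ) : ℕ :=
  (univ.filter fun x : Fin ψ.n × Fin (ψ.dH + ψ.dH) => ψ.C x.1 x.2 (σ x.1) (σ (ψ.G.lazy.nbr x.1 x.2)) = false).card

/-- Satisfiability by values `< W`. [cite: AroraBarakCC2009, §22.2.4] -/
def Sat (ψ : LazyCSP) : Prop := ∃ σ : Fin ψ.n → ℕ, (∀ u, σ u < ψ.W) ∧ ∀ v i, ψ.C v i (σ v) (σ (ψ.G.lazy.nbr v i)) = true

/-- `ψ.Gap r`: every assignment of values `< W` violates at least `r · n · (2 dH)` darts. [cite: AroraBarakCC2009, §22.2.4] -/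
def Gap (ψ : LazyCSP) (r : ℝ) : Prop := ∀ σ : Fin ψ.n → ℕ, (∀ u, σ u < ψ.W) → r * (ψ.n * (ψ.dH + ψ.dH : ℕ)) ≤ ψ.viol σ

end LazyCSP

/-! ### Parameters of the round -/

/-- The parameters of one round: a family of `d₀`-regular graphs `X k` (one per cloud size, used for degree
reduction), a family of `dX`-regular graphs `XN n` on `Nx n ≥ n` vertices (used to expanderize), the
powering parameter `t`, and the constants `η` (edge expansion of the `X k`) and `cN` (padding ratio).
[cite: AroraBarakCC2009, §22.A and Lemma 22.5 (the explicit expander families and the parameter t)] -/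
structure RoundParams where
  /-- degree of the cloud expanders -/
  d₀ : ℕ
  /-- the cloud expanders -/
  X : (k : ℕ) → RotGraph k d₀
  /-- degree of the vertex-set expanders -/
  dX : ℕ
  /-- the padded size -/
  Nx : ℕ → ℕ
  /-- padding does not shrink -/
  Nx_ge : ∀ n, n ≤ Nx n
  /-- the vertex-set expanders -/
  XN : (n : ℕ) → RotGraph (Nx n) dX
  /-- powering parameter -/
  t : ℕ
  /-- edge expansion of the `X k` -/
  η : ℝ
  /-- padding ratio -/
  cN : ℝ

namespace RoundParams

variable (P : RoundParams)

/-- The arity `q₀ = 864`. [cite: AroraBarakCC2009, Lemma 22.4 (q₀)] -/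
def q : ℕ := q₀

/-- The alphabet `W = 2^{q₀}` of the binary intermediate instances (kept irreducible: `2^864` must never be
evaluated by a tactic). [cite: AroraBarakCC2009, Claim 22.36] -/
@[irreducible] def W : ℕ := 2 ^ q₀

/-- `W = 2^{q₀}`. [folklore] -/
theorem W_def : W = 2 ^ q₀ := by unfold W; rfl

/-- `q₀ ≥ 1`. [folklore] -/
theorem q₀_pos : 0 < q₀ := by rw [q₀_eq]; norm_num

/-- `W ≥ 2`. [folklore] -/
theorem two_le_W : 2 ≤ W := by
  rw [W_def]
  calc 2 = 2 ^ 1 := (pow_one 2).symm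
    _ ≤ 2 ^ q₀ := Nat.pow_le_pow_right (by norm_num) q₀_pos

/-- `W ≥ 1`. [folklore] -/
theorem W_pos : 0 < W := lt_of_lt_of_le (by norm_num) two_le_W

/-- The degree `d₁ = d₀ + 1` after degree reduction. [cite: AroraBarakCC2009, Claim 22.37] -/
def d₁ : ℕ := P.d₀ + 1

/-- The degree `dH = d₁ (1 + dX)` after expanderizing (before laziness). [cite: AroraBarakCC2009, Claim 22.38] -/
def dH : ℕ := P.d₁ + P.dX * P.d₁

/-- The degree `D = 2 dH` of the lazy nice graph. [cite: AroraBarakCC2009, Claim 22.38 ("4d-regular … half … self-loops")] -/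
def D : ℕ := P.dH + P.dH

/-- The ball radius `T = t + ⌊√t⌋`. [cite: AroraBarakCC2009, Lemma 22.9 (t + √t)] -/
def T : ℕ := P.t + Nat.sqrt P.t

/-- The window size `m_w = ⌊√t⌋ / (4W)`. [cite: AroraBarakCC2009, Claim 22.11 (δ√t)] -/
def mw : ℕ := Nat.sqrt P.t / (4 * W)

/-- The number of bits `k₄ = q₀ · ballBound D T` of a value of the powered instance (`W^{ballBound} = 2^{k₄}`).
[cite: AroraBarakCC2009, Lemma 22.9 (1) (alphabet W' = W^{d^{5t}})] -/
def k₄ : ℕ := q₀ * ballBound P.D P.T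

/-- `W ^ ballBound D T = 2 ^ k₄`. [folklore] -/
theorem W_pow : W ^ ballBound P.D P.T = 2 ^ P.k₄ := by rw [W_def, k₄, ← pow_mul]

/-- `D > 0`. [folklore] -/
theorem D_pos : 0 < P.D := by
  show 0 < P.d₀ + 1 + P.dX * (P.d₀ + 1) + (P.d₀ + 1 + P.dX * (P.d₀ + 1)); positivity

/-- `dH > 0`. [folklore] -/
theorem dH_pos : 0 < P.dH := by show 0 < P.d₀ + 1 + P.dX * (P.d₀ + 1); positivity

/-- The conditions under which the round amplifies: positive degrees, edge expansion `η > 0` of every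
`X k`, spectral bound `1/10` for every `XN n`, linear padding, and `t` large. [cite: AroraBarakCC2009, Lemma 22.4 (the constants)] -/
structure Good : Prop where
  d₀_pos : 0 < P.d₀
  dX_pos : 0 < P.dX
  η_pos : 0 < P.η
  edgeExp : ∀ (k : ℕ) (Q : Finset (Fin k)), 2 * Q.card ≤ k →
    P.η * Q.card ≤ ((univ.filter fun x : Fin k × Fin P.d₀ => x.1 ∈ Q ∧ (P.X k).nbr x.1 x.2 ∉ Q).card : ℝ)
  spectral : ∀ n, SpectralBound (P.XN n).walkMatrix (1 / 10)
  cN_pos : 0 < P.cN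
  Nx_le : ∀ n, 0 < n → (P.Nx n : ℝ) ≤ P.cN * n
  mw_pos : 1 ≤ P.mw
  big : 64 * (W : ℝ) ^ 4 * (2 + 18 * P.D) * ((q₀ : ℝ) * (2 * P.d₁) * P.cN * (2 * (1 + P.dX))) ≤ P.mw * min 2 P.η

end RoundParams

/-! ### Stage 1: arity reduction (Claim 22.36) -/

namespace BCSP

variable {q : ℕ}

/-- **Stage 1** (Claim 22.36): the binary instance over `[2^q]`. [cite: AroraBarakCC2009, Claim 22.36] -/
def arity (φ : BCSP q) : EdgeCSP := ⟨φ.nV + φ.cons.length, φ.cons.length * q, 2 ^ q, arEdge φ.vars, arR φ.acc⟩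

/-- Stage 1 preserves satisfiability (`q ≥ 1`). [cite: AroraBarakCC2009, Claim 22.36] -/
theorem arity_sat (hq : 0 < q) {φ : BCSP q} (h : φ.Sat) : (arity φ).Sat := by
  obtain ⟨σ, hσ⟩ := h
  exact ⟨arLift φ.vars σ, arLift_lt φ.vars hq σ, fun x => arR_arLift φ.vars φ.acc hσ x⟩

/-- Stage 1 divides the gap by `q`: `φ.Gap r → (arity φ).Gap (r/q)` (`q ≥ 1`). [cite: AroraBarakCC2009, Claim 22.36] -/
theorem arity_gap (hq : 0 < q) {φ : BCSP q} {r : ℝ} (h : φ.Gap r) : (arity φ).Gap (r / q) := by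
  intro σ' _
  have hN : ∀ σ : Fin φ.nV → Bool, ⌈r * φ.cons.length⌉₊ ≤ (univ.filter fun s => φ.acc s (σ ∘ φ.vars s) = false).card := fun σ =>
    Nat.ceil_le.2 (h σ)
  have hs := arityReduction_soundness φ.vars φ.acc hq hN σ'
  have hqR : (0 : ℝ) < q := by exact_mod_cast hq
  unfold arity EdgeCSP.viol
  simp only
  push_cast
  calc r / q * (φ.cons.length * q) = r * φ.cons.length := by field_simp
    _ ≤ ⌈r * φ.cons.length⌉₊ := Nat.le_ceil _
    _ ≤ _ := by exact_mod_cast hs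

end BCSP

namespace RoundParams

/-- Stage 1 at arity `q₀`, with the alphabet written as the constant `W`. [cite: AroraBarakCC2009, Claim 22.36] -/
def arityW (φ : BCSP q₀) : EdgeCSP := ⟨φ.nV + φ.cons.length, φ.cons.length * q₀, W, arEdge φ.vars, arR φ.acc⟩

/-- Stage 1 preserves satisfiability. [cite: AroraBarakCC2009, Claim 22.36] -/
theorem arityW_sat {φ : BCSP q₀} (h : φ.Sat) : (arityW φ).Sat := by
  obtain ⟨σ, hσ⟩ := h
  refine ⟨arLift φ.vars σ, fun u => ?_, fun x => arR_arLift φ.vars φ.acc hσ x⟩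
  show arLift φ.vars σ u < W
  rw [W_def]
  exact arLift_lt φ.vars q₀_pos σ u

/-- Stage 1 divides the gap by `q₀`. [cite: AroraBarakCC2009, Claim 22.36] -/
theorem arityW_gap {φ : BCSP q₀} {r : ℝ} (h : φ.Gap r) : (arityW φ).Gap (r / q₀) := by
  intro σ' _
  have hN : ∀ σ : Fin φ.nV → Bool, ⌈r * φ.cons.length⌉₊ ≤ (univ.filter fun s => φ.acc s (σ ∘ φ.vars s) = false).card := fun σ =>
    Nat.ceil_le.2 (h σ)
  have hs := arityReduction_soundness φ.vars φ.acc q₀_pos hN σ'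
  have hqR : (0 : ℝ) < q₀ := by exact_mod_cast q₀_pos
  show r / q₀ * ((φ.cons.length * q₀ : ℕ) : ℝ) ≤
    ((univ.filter fun s : Fin (φ.cons.length * q₀) => arR φ.acc s (σ' (arEdge φ.vars s).1) (σ' (arEdge φ.vars s).2) = false).card : ℝ)
  rw [Nat.cast_mul]
  calc r / q₀ * (φ.cons.length * q₀) = r * φ.cons.length := by field_simp
    _ ≤ ⌈r * φ.cons.length⌉₊ := Nat.le_ceil _
    _ ≤ _ := by exact_mod_cast hs

end RoundParams

/-! ### Stage 2: degree reduction (Claim 22.37) -/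

namespace EdgeCSP

variable (P : RoundParams)

/-- **Stage 2** (Claim 22.37): the `(d₀+1)`-regular instance on the `2m` occurrences, in lazy-ready form
(graph of degree `d₁`, but not yet padded/expanderized). [cite: AroraBarakCC2009, Claim 22.37] -/
def degreeG (ψ : EdgeCSP) : RotGraph (ψ.m * 2) P.d₁ := reduced ψ.e P.X

/-- The dart constraints of Stage 2. [cite: AroraBarakCC2009, Claim 22.37] -/
def degreeC (ψ : EdgeCSP) : Fin (ψ.m * 2) → Fin P.d₁ → ℕ → ℕ → Bool := reducedC ψ.R

/-- Stage 2 preserves satisfiability. [cite: AroraBarakCC2009, Claim 22.37] -/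
theorem degree_sat {ψ : EdgeCSP} (h : ψ.Sat) :
    ∃ σ : Fin (ψ.m * 2) → ℕ, (∀ u, σ u < ψ.W) ∧ ∀ v i, degreeC P ψ v i (σ v) (σ ((degreeG P ψ).nbr v i)) = true := by
  obtain ⟨σ, hσ, hsat⟩ := h
  exact ⟨liftOcc ψ.e σ, fun _ => hσ _, fun v i => reducedC_lift ψ.e P.X ψ.R hsat v i⟩

/-- Stage 2 soundness: `ψ.Gap ε` gives `min(2, η) · ε · m ≤ #violated darts` for every assignment of values
`< W` (`W ≥ 1`, edge expansion `η ≥ 0`). [cite: AroraBarakCC2009, Claim 22.37] -/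
theorem degree_gap (hG : P.Good) {ψ : EdgeCSP} (hW : 0 < ψ.W) {ε : ℝ} (h : ψ.Gap ε) (y : Fin (ψ.m * 2) → ℕ)
    (hy : ∀ v, y v < ψ.W) :
    min 2 P.η * (ε * ψ.m) ≤ ((univ.filter fun x : Fin (ψ.m * 2) × Fin P.d₁ =>
      degreeC P ψ x.1 x.2 (y x.1) (y ((degreeG P ψ).nbr x.1 x.2)) = false).card : ℝ) :=
  degreeReduction_soundness ψ.e P.X ψ.R ψ.W y hG.η_pos.le hG.edgeExp hW h hy

end EdgeCSP

/-! ### Stage 3: padding, expanderizing, laziness (Claim 22.38) -/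

namespace RoundParams

variable (P : RoundParams)

/-- **Stage 3** (Claim 22.38): pad the `d₁`-regular constraint graph on `n` vertices to `Nx n` vertices and
unite it with `d₁` copies of the expander `XN n`; the instance lives on the lazy version.
[cite: AroraBarakCC2009, Claim 22.38] -/
def padExp {n : ℕ} (G : RotGraph n P.d₁) (C : Fin n → Fin P.d₁ → ℕ → ℕ → Bool) (W : ℕ) : LazyCSP :=
  ⟨P.Nx n, P.dH, W, (G.pad (P.Nx_ge n)).prep (P.XN n), lazyC (prepC (padC C (P.Nx n)))⟩

/-- Stage 3 preserves satisfiability (`W ≥ 1`). [cite: AroraBarakCC2009, Claim 22.38] -/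
theorem padExp_sat {n : ℕ} (G : RotGraph n P.d₁) {C : Fin n → Fin P.d₁ → ℕ → ℕ → Bool} {W : ℕ} (hW : 0 < W)
    (h : ∃ σ : Fin n → ℕ, (∀ u, σ u < W) ∧ ∀ v i, C v i (σ v) (σ (G.nbr v i)) = true) : (P.padExp G C W).Sat := by
  obtain ⟨σ, hσ, hsat⟩ := h
  let σ' : Fin (P.Nx n) → ℕ := fun v => if h : v.val < n then σ ⟨v.val, h⟩ else 0
  have hres : ∀ v : Fin n, σ' (Fin.castLE (P.Nx_ge n) v) = σ v := fun v => by
    simp only [σ', Fin.val_castLE, v.2, dite_true]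
  refine ⟨σ', fun v => by simp only [σ']; split_ifs <;> [exact hσ _; exact hW], fun v i => ?_⟩
  exact lazyC_prepC_of_forall _ _ (padC_of_forall G (P.Nx_ge n) fun v i => by rw [hres, hres]; exact hsat v i) v i

/-- The spectral bound of Stage 3's lazy graph. [cite: AroraBarakCC2009, Claim 22.38] -/
theorem padExp_spectral (hG : P.Good) {n : ℕ} (G : RotGraph n P.d₁) (C : Fin n → Fin P.d₁ → ℕ → ℕ → Bool) (W : ℕ) :
    SpectralBound (P.padExp G C W).G.lazy.walkMatrix (9 / 10) :=
  spectralBound_lazy_prep _ _ (Nat.succ_pos _) hG.dX_pos (hG.spectral n) le_rfl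

/-- Stage 3 soundness: if every assignment of values `< W` violates at least `a` darts of `(G, C)` (`a ≥ 0`),
the lazy padded expanderized instance has gap `a / (N · D)`. [cite: AroraBarakCC2009, Claim 22.38] -/
theorem padExp_gap {n : ℕ} (G : RotGraph n P.d₁) (C : Fin n → Fin P.d₁ → ℕ → ℕ → Bool) (W : ℕ) {a : ℝ}
    (h : ∀ σ : Fin n → ℕ, (∀ u, σ u < W) →
      a ≤ ((univ.filter fun x : Fin n × Fin P.d₁ => C x.1 x.2 (σ x.1) (σ (G.nbr x.1 x.2)) = false).card : ℝ))
    (hN : 0 < P.Nx n) : (P.padExp G C W).Gap (a / (P.Nx n * P.D)) := by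
  intro σ hσ
  have hviol : (P.padExp G C W).viol σ =
      (univ.filter fun x : Fin n × Fin P.d₁ => C x.1 x.2 (σ (Fin.castLE (P.Nx_ge n) x.1))
        (σ (Fin.castLE (P.Nx_ge n) (G.nbr x.1 x.2))) = false).card := by
    unfold padExp LazyCSP.viol
    exact (card_violated_lazyC_prepC _ _ _ σ).trans (card_violated_pad G (P.Nx_ge n) C σ)
  rw [hviol]
  have hD : (0 : ℝ) < P.D := by exact_mod_cast P.D_pos
  have hNR : (0 : ℝ) < P.Nx n := by exact_mod_cast hN
  calc a / (P.Nx n * P.D) * ((P.padExp G C W).n * (((P.padExp G C W).dH + (P.padExp G C W).dH : ℕ) : ℝ)) = a := by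
        show a / (P.Nx n * P.D) * (P.Nx n * ((P.D : ℕ) : ℝ)) = a
        field_simp
    _ ≤ _ := h (fun v => σ (Fin.castLE (P.Nx_ge n) v)) fun u => hσ _

end RoundParams

/-! ### Stage 4: powering and alphabet reduction (Lemmas 22.9, 22.6) -/

/-! #### Explicit numberings -/

namespace Enc

/-- Pairs. [folklore] -/
def pairFin {α β : Type} {a b : ℕ} (ea : α ≃ Fin a) (eb : β ≃ Fin b) : α × β ≃ Fin (a * b) := (Equiv.prodCongr ea eb).trans finProdFinEquiv

/-- Functions from `Fin T`. [folklore] -/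
def funFin {α : Type} {a : ℕ} (T : ℕ) (ea : α ≃ Fin a) : (Fin T → α) ≃ Fin (a ^ T) :=
  (Equiv.arrowCongr (Equiv.refl (Fin T)) ea).trans finFunctionFinEquiv

/-- Sums. [folklore] -/
def sumFin {α β : Type} {a b : ℕ} (ea : α ≃ Fin a) (eb : β ≃ Fin b) : α ⊕ β ≃ Fin (a + b) := (Equiv.sumCongr ea eb).trans finSumFinEquiv

/-- Bit vectors. [folklore] -/
def vecFin (ι : ℕ) : (Fin ι → Bool) ≃ Fin (2 ^ ι) := boolVecEquiv ι

/-- The size of `Coins n m`. [folklore] -/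
def cc (n m : ℕ) : ℕ :=
  (2 ^ n * 2 ^ n) ^ T₁ * ((2 ^ (n * n) * 2 ^ (n * n)) ^ T₁ * ((2 ^ n * (2 ^ n * 2 ^ (n * n))) ^ T₂ * (2 ^ m * 2 ^ (n * n)) ^ T₃))

/-- The numbering of `Coins n m`. [folklore] -/
def coinsFin (n m : ℕ) : Coins n m ≃ Fin (cc n m) :=
  pairFin (funFin T₁ (pairFin (vecFin n) (vecFin n)))
    (pairFin (funFin T₁ (pairFin (vecFin (n * n)) (vecFin (n * n))))
      (pairFin (funFin T₂ (pairFin (vecFin n) (pairFin (vecFin n) (vecFin (n * n)))))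
        (funFin T₃ (pairFin (vecFin m) (vecFin (n * n))))))

/-- The size of `TCoins k`. [folklore] -/
def tc (k : ℕ) : ℕ := cc (nv k) (ne k) * ((2 ^ k * 2 ^ k) ^ T₁ * ((2 ^ k * 2 ^ k) ^ T₁ * (2 ^ k * (2 ^ k * 2 ^ nv k)) ^ T₄))

/-- The numbering of `TCoins k`. [folklore] -/
def tcoinsFin (k : ℕ) : TCoins k ≃ Fin (tc k) :=
  pairFin (coinsFin (nv k) (ne k))
    (pairFin (funFin T₁ (pairFin (vecFin k) (vecFin k)))
      (pairFin (funFin T₁ (pairFin (vecFin k) (vecFin k))) (funFin T₄ (pairFin (vecFin k) (pairFin (vecFin k) (vecFin (nv k)))))))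

/-- The size of the variable set of the alphabet-reduced instance with `N` old variables, `N L` constraints and
`k` bits. [folklore] -/
def nvars (N L k : ℕ) : ℕ := N * 2 ^ k + N * L * (2 ^ nv k + 2 ^ (nv k * nv k))

/-- The numbering of the new variables. [folklore] -/
def newVarFin (N L k : ℕ) : AlphabetReduction.NewVar (Fin N) (Fin N × Fin L) k ≃ Fin (nvars N L k) :=
  sumFin (pairFin (Equiv.refl (Fin N)) (vecFin k))
    (pairFin (pairFin (Equiv.refl (Fin N)) (Equiv.refl (Fin L))) (sumFin (vecFin (nv k)) (vecFin (nv k * nv k))))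

end Enc

/-! #### The two-value form of a walk constraint -/

namespace RotGraph

variable {n d : ℕ} (G : RotGraph n d)

/-- The walk constraint of `ψᵗ` as a binary relation on the two values `(a, b)` of its endpoints (the value
`y v` and the value `y (endpt v l)` in `WalkSat`). [cite: AroraBarakCC2009, Lemma 22.9 (proof, the constraint C_p)] -/
def WalkRel (W T : ℕ) (C : Fin n → Fin d → ℕ → ℕ → Bool) (v : Fin n) (l : List (Fin d)) (a b : ℕ) : Prop :=
  ∀ (j : ℕ) (i : Fin d), l[j]? = some i →
    G.endpt v (l.take j) ∈ G.ballList T v →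
    G.nbr (G.endpt v (l.take j)) i ∈ G.ballList T (G.endpt v l) →
    C (G.endpt v (l.take j)) i (digit W a ((G.ballList T v).idxOf (G.endpt v (l.take j))))
      (digit W b ((G.ballList T (G.endpt v l)).idxOf (G.nbr (G.endpt v (l.take j)) i))) = true

/-- `WalkSat y v l` is `WalkRel v l (y v) (y (endpt v l))`. [folklore] -/
theorem walkSat_iff_walkRel (W T : ℕ) (C : Fin n → Fin d → ℕ → ℕ → Bool) (y : Fin n → ℕ) (v : Fin n) (l : List (Fin d)) :
    G.WalkSat W T C y v l ↔ G.WalkRel W T C v l (y v) (y (G.endpt v l)) := Iff.rfl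

/-- Decidability of `WalkRel`. [folklore] -/
instance decidableWalkRel (W T : ℕ) (C : Fin n → Fin d → ℕ → ℕ → Bool) (v : Fin n) (l : List (Fin d)) (a b : ℕ) :
    Decidable (G.WalkRel W T C v l a b) := by
  unfold WalkRel
  have : (∀ (j : ℕ) (i : Fin d), l[j]? = some i →
      G.endpt v (l.take j) ∈ G.ballList T v →
      G.nbr (G.endpt v (l.take j)) i ∈ G.ballList T (G.endpt v l) →
      C (G.endpt v (l.take j)) i (digit W a ((G.ballList T v).idxOf (G.endpt v (l.take j))))
        (digit W b ((G.ballList T (G.endpt v l)).idxOf (G.nbr (G.endpt v (l.take j)) i))) = true) ↔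
      ∀ j : Fin l.length,
        G.endpt v (l.take j) ∈ G.ballList T v →
        G.nbr (G.endpt v (l.take j)) l[j] ∈ G.ballList T (G.endpt v l) →
        C (G.endpt v (l.take j)) l[j] (digit W a ((G.ballList T v).idxOf (G.endpt v (l.take j))))
          (digit W b ((G.ballList T (G.endpt v l)).idxOf (G.nbr (G.endpt v (l.take j)) l[j]))) = true := by
    constructor
    · intro h j; exact h j.1 l[j] (List.getElem?_eq_getElem j.2)
    · intro h j i hji
      have hj : j < l.length := (List.getElem?_eq_some_iff.1 hji).1
      have hi : l[j] = i := (List.getElem?_eq_some_iff.1 hji).2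
      subst hi
      exact h ⟨j, hj⟩
  rw [this]
  infer_instance

end RotGraph

/-! #### The stage -/

namespace LazyCSP

variable (P : RoundParams) (ψ : LazyCSP)

/-- The index set of the walk constraints of `ψᵗ`: (start vertex, label of the walk of length `2t+1`). [cite: AroraBarakCC2009, Lemma 22.9 (one constraint per (2t+1)-step path)] -/
abbrev S₄ : Type := Fin ψ.n × Fin ((ψ.dH + ψ.dH) ^ (2 * P.t + 1))

/-- The first endpoint of a walk constraint. [folklore] -/
def wfst (s : ψ.S₄ P) : Fin ψ.n := s.1

/-- The second endpoint of a walk constraint. [folklore] -/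
def wsnd (s : ψ.S₄ P) : Fin ψ.n := ψ.G.lazy.endpt s.1 (listOfLab (2 * P.t + 1) s.2)

/-- Numbers from bit vectors. [folklore] -/
def toNat {k : ℕ} (a : Fin k → Bool) : ℕ := (boolVecEquiv k a).val

/-- The walk constraint as a relation on `k`-bit strings. [cite: AroraBarakCC2009, Lemma 22.9 and Lemma 22.6 ("think of each variable as taking values that are bit strings")] -/
def wrel (k : ℕ) (s : ψ.S₄ P) (a b : Fin k → Bool) : Bool :=
  decide (ψ.G.lazy.WalkRel ψ.W P.T ψ.C s.1 (listOfLab (2 * P.t + 1) s.2) (toNat a) (toNat b))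

/-- The explicit numbering of the pairs (walk constraint, coin tuple). [folklore] -/
def scEquiv (k : ℕ) : ψ.S₄ P × TCoins k ≃ Fin (ψ.n * (ψ.dH + ψ.dH) ^ (2 * P.t + 1) * Enc.tc k) :=
  Enc.pairFin (Enc.pairFin (Equiv.refl _) (Equiv.refl _)) (Enc.tcoinsFin k)

/-- The constraint with number `i`: the tester constraint of the pair `scEquiv⁻¹ i`. [cite: AroraBarakCC2009, §22.2.1 (f = h ∘ g)] -/
def consOf (k : ℕ) (i : Fin (ψ.n * (ψ.dH + ψ.dH) ^ (2 * P.t + 1) * Enc.tc k)) :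
    (Fin q₀ → Fin (Enc.nvars ψ.n ((ψ.dH + ψ.dH) ^ (2 * P.t + 1)) k)) × ((Fin q₀ → Bool) → Bool) :=
  (Enc.newVarFin _ _ k ∘ consVars (ψ.wfst P) (ψ.wsnd P) (ψ.wrel P k) ((ψ.scEquiv P k).symm i).1 ((ψ.scEquiv P k).symm i).2,
    consAcc (ψ.wrel P k) ((ψ.scEquiv P k).symm i).1 ((ψ.scEquiv P k).symm i).2)

/-- **Stage 4** (Lemmas 22.9 and 22.6): power the lazy instance, reduce the alphabet with the Hadamard tester,
and render the tester's checks as `q₀`-ary Boolean constraints, with `k` bits per value.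
[cite: AroraBarakCC2009, §22.2.1 (f = h ∘ g)] -/
def powAlpha (k : ℕ) : BCSP q₀ := ⟨Enc.nvars ψ.n ((ψ.dH + ψ.dH) ^ (2 * P.t + 1)) k, List.ofFn (ψ.consOf P k)⟩

/-- The number of constraints of Stage 4. [folklore] -/
theorem powAlpha_length (k : ℕ) : (ψ.powAlpha P k).cons.length = ψ.n * (ψ.dH + ψ.dH) ^ (2 * P.t + 1) * Enc.tc k :=
  List.length_ofFn

/-- The pair (walk constraint, coins) behind constraint number `s`. [folklore] -/
def scOf (k : ℕ) (s : Fin (ψ.powAlpha P k).cons.length) : ψ.S₄ P × TCoins k :=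
  (ψ.scEquiv P k).symm ⟨s.val, lt_of_lt_of_eq s.2 (ψ.powAlpha_length P k)⟩

/-- `scOf` is a bijection. [folklore] -/
theorem scOf_bijective (k : ℕ) : Function.Bijective (ψ.scOf P k) := by
  refine ⟨fun s s' h => ?_, fun p => ?_⟩
  · have := (ψ.scEquiv P k).symm.injective h
    exact Fin.ext (by simpa using congrArg Fin.val this)
  · refine ⟨⟨(ψ.scEquiv P k p).val, lt_of_lt_of_eq (ψ.scEquiv P k p).2 (ψ.powAlpha_length P k).symm⟩, ?_⟩
    unfold scOf
    rw [Equiv.symm_apply_eq]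

/-- **The constraint `s` of Stage 4 evaluated on a global assignment is `[NewSat]` of its pair.** [cite: AroraBarakCC2009, §22.2.5] -/
theorem powAlpha_acc_apply (k : ℕ) (σ : Fin (ψ.powAlpha P k).nV → Bool) (s : Fin (ψ.powAlpha P k).cons.length) :
    (ψ.powAlpha P k).acc s (σ ∘ (ψ.powAlpha P k).vars s) =
      decide (AlphabetReduction.NewSat (ψ.wfst P) (ψ.wsnd P) (ψ.wrel P k) (σ ∘ Enc.newVarFin _ _ k)
        (ψ.scOf P k s).1 (ψ.scOf P k s).2) := by
  have hget : (ψ.powAlpha P k).cons[s] = ψ.consOf P k ⟨s.val, lt_of_lt_of_eq s.2 (ψ.powAlpha_length P k)⟩ := by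
    show (List.ofFn (ψ.consOf P k))[s.val] = _
    rw [List.getElem_ofFn]
  unfold BCSP.acc BCSP.vars
  rw [hget]
  exact consAcc_apply (ψ.wfst P) (ψ.wsnd P) (ψ.wrel P k) (σ ∘ Enc.newVarFin _ _ k) (ψ.scOf P k s).1 (ψ.scOf P k s).2

/-- The violated constraints of Stage 4 under `σ` are the violated tester constraints under the corresponding
assignment of the new variables. [folklore] -/
theorem powAlpha_viol (k : ℕ) (σ : Fin (ψ.powAlpha P k).nV → Bool) :
    (ψ.powAlpha P k).viol σ = (univ.filter fun p : ψ.S₄ P × TCoins k =>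
      ¬ AlphabetReduction.NewSat (ψ.wfst P) (ψ.wsnd P) (ψ.wrel P k) (σ ∘ Enc.newVarFin _ _ k) p.1 p.2).card := by
  classical
  unfold BCSP.viol
  refine card_bij (fun s _ => ψ.scOf P k s) (fun s hs => ?_) (fun s _ s' _ h => (ψ.scOf_bijective P k).1 h) (fun p hp => ?_)
  · rw [mem_filter] at hs ⊢
    refine ⟨mem_univ _, ?_⟩
    have h2 := hs.2
    rw [powAlpha_acc_apply, decide_eq_false_iff_not] at h2
    exact h2
  · obtain ⟨s, rfl⟩ := (ψ.scOf_bijective P k).2 p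
    refine ⟨s, ?_, rfl⟩
    rw [mem_filter] at hp ⊢
    refine ⟨mem_univ _, ?_⟩
    rw [powAlpha_acc_apply, decide_eq_false_iff_not]
    exact hp.2

/-- The walk constraints as counted by powering and as counted through `S₄`. [folklore] -/
theorem card_not_walkSat_eq (y : Fin ψ.n → ℕ) :
    ((((univ : Finset (Fin ψ.n)) ×ˢ seqs (ψ.dH + ψ.dH) (2 * P.t + 1)).filter
        fun w => ¬ ψ.G.lazy.WalkSat ψ.W P.T ψ.C y w.1 w.2).card) =
      (univ.filter fun s : ψ.S₄ P => ¬ ψ.G.lazy.WalkSat ψ.W P.T ψ.C y s.1 (listOfLab (2 * P.t + 1) s.2)).card := by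
  classical
  symm
  refine card_bij (fun s _ => (s.1, listOfLab (2 * P.t + 1) s.2)) (fun s hs => ?_) (fun s _ s' _ h => ?_) (fun w hw => ?_)
  · rw [mem_filter] at hs ⊢
    exact ⟨mem_product.2 ⟨mem_univ _, mem_seqs.2 (length_listOfLab _ _)⟩, hs.2⟩
  · simp only [Prod.mk.injEq] at h
    exact Prod.ext h.1 ((labEquiv _ _).injective (Subtype.ext h.2))
  · rw [mem_filter, mem_product] at hw
    refine ⟨(w.1, (labEquiv _ _).symm ⟨w.2, mem_seqs.1 hw.1.2⟩), ?_, ?_⟩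
    · rw [mem_filter]
      refine ⟨mem_univ _, ?_⟩
      simp only [listOfLab_symm]
      exact hw.2
    · simp only [listOfLab_symm]

/-- Stage 4 preserves satisfiability (`W ≥ 2`, `W^{ballBound} = 2^k`). [cite: AroraBarakCC2009, Lemma 22.9 (2) and Lemma 22.6] -/
theorem powAlpha_sat (hW : 2 ≤ ψ.W) {k : ℕ} (hk : ψ.W ^ ballBound (ψ.dH + ψ.dH) P.T = 2 ^ k) (h : ψ.Sat) :
    (ψ.powAlpha P k).Sat := by
  classical
  obtain ⟨y, hy, hsat⟩ := ψ.G.lazy.exists_walkSat_of_sat (T := P.T) hW h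
  -- values as `k`-bit strings
  let σ₄ : Fin ψ.n → Fin k → Bool := fun v => (boolVecEquiv k).symm ⟨y v, by rw [← hk]; exact hy v⟩
  have hto : ∀ v, toNat (σ₄ v) = y v := fun v => by simp [toNat, σ₄]
  have hrel : ∀ s : ψ.S₄ P, ψ.wrel P k s (σ₄ (ψ.wfst P s)) (σ₄ (ψ.wsnd P s)) = true := fun s => by
    unfold wrel wfst wsnd
    rw [hto, hto, decide_eq_true_eq, ← RotGraph.walkSat_iff_walkRel]
    exact hsat _ _
  let A := AlphabetReduction.encode (ψ.wfst P) (ψ.wsnd P) σ₄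
  refine ⟨A ∘ (Enc.newVarFin _ _ k).symm, fun s => ?_⟩
  rw [powAlpha_acc_apply, decide_eq_true_eq]
  have hA : (A ∘ ⇑(Enc.newVarFin ψ.n ((ψ.dH + ψ.dH) ^ (2 * P.t + 1)) k).symm) ∘
      ⇑(Enc.newVarFin ψ.n ((ψ.dH + ψ.dH) ^ (2 * P.t + 1)) k) = A := by
    funext j; simp only [Function.comp_apply, Equiv.symm_apply_apply]
  show AlphabetReduction.NewSat (ψ.wfst P) (ψ.wsnd P) (ψ.wrel P k)
    ((A ∘ ⇑(Enc.newVarFin ψ.n ((ψ.dH + ψ.dH) ^ (2 * P.t + 1)) k).symm) ∘ ⇑(Enc.newVarFin ψ.n ((ψ.dH + ψ.dH) ^ (2 * P.t + 1)) k))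
    (ψ.scOf P k s).1 (ψ.scOf P k s).2
  rw [hA]
  exact AlphabetReduction.newSat_encode _ _ _ hrel _ _

/-- Stage 4 soundness: from the gap of the lazy nice instance (values `< W`, spectral bound `9/10`, the window
conditions of powering) to the gap of the Boolean instance.
[cite: AroraBarakCC2009, Lemma 22.9 (3) and Lemma 22.6] -/
theorem powAlpha_gap (hdH : 0 < ψ.dH) (hn : 0 < ψ.n) (hlam : SpectralBound ψ.G.lazy.walkMatrix (9 / 10)) (hW : 0 < ψ.W)
    {mw : ℕ} (hmw : 1 ≤ mw) (h4 : 4 * ψ.W * mw ≤ Nat.sqrt P.t) {ε : ℝ} (hε0 : 0 ≤ ε) (h : ψ.Gap ε) (k : ℕ) :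
    (ψ.powAlpha P k).Gap ((mw * ε / (16 * (ψ.W : ℝ) ^ 4 * (1 + 18 * (ψ.dH + ψ.dH : ℕ) + 2 * mw * ((ψ.dH + ψ.dH : ℕ) : ℝ) ^ 2 * ε))) / 2) := by
  classical
  intro σ
  set A := σ ∘ Enc.newVarFin _ _ k
  set ε₄ : ℝ := mw * ε / (16 * (ψ.W : ℝ) ^ 4 * (1 + 18 * (ψ.dH + ψ.dH : ℕ) + 2 * mw * ((ψ.dH + ψ.dH : ℕ) : ℝ) ^ 2 * ε))
  rw [powAlpha_viol, powAlpha_length]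
  -- every assignment of bit strings to the vertices violates `⌈ε₄ n D^ℓ⌉` walk constraints
  have hN : ∀ τ : Fin ψ.n → Fin k → Bool, ⌈ε₄ * (ψ.n * (((ψ.dH + ψ.dH : ℕ) : ℝ)) ^ (2 * P.t + 1))⌉₊ ≤
      (univ.filter fun s : ψ.S₄ P => ψ.wrel P k s (τ (ψ.wfst P s)) (τ (ψ.wsnd P s)) = false).card := fun τ => by
    have hp := ψ.G.powering_soundness ψ.W P.T P.t (fun v => toNat (τ v)) ψ.C hdH hn hlam le_rfl hW rfl hmw h4 hε0 h
    rw [card_not_walkSat_eq] at hp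
    refine Nat.ceil_le.2 (hp.trans (le_of_eq ?_))
    congr 2
    ext s
    simp only [mem_filter, mem_univ, true_and, wrel, wfst, wsnd, RotGraph.walkSat_iff_walkRel, decide_eq_false_iff_not]
  have hsound := AlphabetReduction.mul_card_TCoins_le_of_forall (ψ.wfst P) (ψ.wsnd P) (ψ.wrel P k) _ hN A
  have hcard : Fintype.card (TCoins k) = Enc.tc k := by
    rw [← Fintype.card_fin (Enc.tc k)]; exact Fintype.card_congr (Enc.tcoinsFin k)
  rw [hcard] at hsound
  have hsoundR : (⌈ε₄ * (ψ.n * (((ψ.dH + ψ.dH : ℕ) : ℝ)) ^ (2 * P.t + 1))⌉₊ : ℝ) * Enc.tc k ≤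
      2 * ((univ.filter fun p : ψ.S₄ P × TCoins k =>
        ¬ AlphabetReduction.NewSat (ψ.wfst P) (ψ.wsnd P) (ψ.wrel P k) A p.1 p.2).card : ℝ) := by exact_mod_cast hsound
  have hceil := Nat.le_ceil (ε₄ * (ψ.n * (((ψ.dH + ψ.dH : ℕ) : ℝ)) ^ (2 * P.t + 1)))
  have htc : (0 : ℝ) ≤ Enc.tc k := Nat.cast_nonneg _
  have key := (mul_le_mul_of_nonneg_right hceil htc).trans hsoundR
  rw [Nat.cast_mul, Nat.cast_mul, Nat.cast_pow]
  linarith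

end LazyCSP

/-! ### The round -/

namespace RoundParams

variable (P : RoundParams)

/-- **One round of gap amplification** `f = h ∘ g` (identity on instances without constraints).
[cite: AroraBarakCC2009, Lemma 22.4 and §22.2.1] -/
def round (φ : BCSP q₀) : BCSP q₀ :=
  if φ.cons.length = 0 then φ
  else (P.padExp (EdgeCSP.degreeG P (arityW φ)) (EdgeCSP.degreeC P (arityW φ)) W).powAlpha P P.k₄

/-- The size constant of the round: `2 q₀ cN · D^{2t+1} · |TCoins k₄|` constraints per constraint. [cite: AroraBarakCC2009, Lemma 22.4 ("less than Cm constraints")] -/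
def roundC : ℝ := 2 * q₀ * P.cN * ((P.D : ℝ) ^ (2 * P.t + 1) * Enc.tc P.k₄)

/-- The soundness floor `ε₀` of the round. [cite: AroraBarakCC2009, Lemma 22.4 (ε₀)] -/
def ε₀ : ℝ := 1 / (64 * (W : ℝ) ^ 4 * (P.D : ℝ) ^ 2 * (2 + 18 * P.D))

/-- **Linear size** (Lemma 22.4: "`ψ` has less than `Cm` constraints"): under `P.Good`, `round P φ` has at
most `roundC P · m` constraints. [cite: AroraBarakCC2009, Lemma 22.4 (1)] -/
theorem round_length_le (hG : P.Good) (φ : BCSP q₀) : ((P.round φ).cons.length : ℝ) ≤ P.roundC * φ.cons.length := by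
  by_cases h : φ.cons.length = 0
  · rw [round, if_pos h, h, Nat.cast_zero, mul_zero]
  · rw [round, if_neg h, LazyCSP.powAlpha_length]
    have hm : 0 < φ.cons.length := Nat.pos_of_ne_zero h
    have hn : 0 < φ.cons.length * q₀ * 2 := by have := q₀_pos; positivity
    have hNx := hG.Nx_le (φ.cons.length * q₀ * 2) hn
    -- the size: `Nx n₂ * D^(2t+1) * tc ≤ (cN n₂) D^(2t+1) tc = roundC m`
    show (((P.Nx (φ.cons.length * q₀ * 2)) * (P.D) ^ (2 * P.t + 1) * Enc.tc P.k₄ : ℕ) : ℝ) ≤ P.roundC * φ.cons.length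
    unfold roundC
    push_cast at hNx ⊢
    have h0 : (0 : ℝ) ≤ (P.D : ℝ) ^ (2 * P.t + 1) * Enc.tc P.k₄ := mul_nonneg (pow_nonneg (Nat.cast_nonneg _) _) (Nat.cast_nonneg _)
    nlinarith [mul_le_mul_of_nonneg_right hNx h0, hG.cN_pos]

/-- **Completeness of the round** (Lemma 22.4 (2): "if `φ` is satisfiable then so is `ψ`").
[cite: AroraBarakCC2009, Lemma 22.4 (2)] -/
theorem round_sat {φ : BCSP q₀} (h : φ.Sat) : (P.round φ).Sat := by
  by_cases hm : φ.cons.length = 0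
  · rw [round, if_pos hm]; exact h
  · rw [round, if_neg hm]
    have h1 := arityW_sat h
    have h2 := EdgeCSP.degree_sat P h1
    have h3 := P.padExp_sat (EdgeCSP.degreeG P (arityW φ)) (W := W) W_pos h2
    exact LazyCSP.powAlpha_sat P _ two_le_W P.W_pow h3

/-- **Soundness of the round (Arora–Barak, Lemma 22.4 (3), "PCP Main Lemma").**  Under `P.Good`: if every
assignment violates at least an `r`-fraction of the constraints of `φ` (`0 ≤ r`), then every assignment
violates at least a `min(2r, ε₀ P)`-fraction of the constraints of `round P φ`
("`val(φ) ≤ 1 - ε ⇒ val(ψ) ≤ 1 - 2ε` for every `ε < ε₀`").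
[cite: AroraBarakCC2009, Lemma 22.4 (3)] -/
theorem round_gap (hG : P.Good) {φ : BCSP q₀} {r : ℝ} (hr0 : 0 ≤ r) (h : φ.Gap r) : (P.round φ).Gap (min (2 * r) P.ε₀) := by
  by_cases hm : φ.cons.length = 0
  · rw [round, if_pos hm]
    intro σ
    rw [hm, Nat.cast_zero, mul_zero]
    exact Nat.cast_nonneg _
  rw [round, if_neg hm]
  -- the parameters
  have hq : 0 < q₀ := q₀_pos
  have hqR : (0 : ℝ) < q₀ := by exact_mod_cast hq
  have hWpos : 0 < W := W_pos
  have hWR : (1 : ℝ) ≤ W := by exact_mod_cast hWpos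
  have hm0 : 0 < φ.cons.length := Nat.pos_of_ne_zero hm
  set ψ₁ := arityW φ with hψ₁
  have hψ₁W : ψ₁.W = W := rfl
  have hψ₁m : ψ₁.m = φ.cons.length * q₀ := rfl
  have hn₂ : 0 < ψ₁.m * 2 := by rw [hψ₁m]; positivity
  set n₂ := ψ₁.m * 2 with hn₂def
  set G₂ := EdgeCSP.degreeG P ψ₁
  set C₂ := EdgeCSP.degreeC P ψ₁
  set ψ₃ := P.padExp G₂ C₂ W with hψ₃
  have hNpos : 0 < P.Nx n₂ := lt_of_lt_of_le hn₂ (P.Nx_ge n₂)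
  -- Stage 1
  have g1 : ψ₁.Gap (r / q₀) := arityW_gap h
  -- Stage 2
  have g2 : ∀ y : Fin n₂ → ℕ, (∀ v, y v < W) →
      min 2 P.η * (r / q₀ * ψ₁.m) ≤ ((univ.filter fun x : Fin n₂ × Fin P.d₁ => C₂ x.1 x.2 (y x.1) (y (G₂.nbr x.1 x.2)) = false).card : ℝ) :=
    fun y hy => EdgeCSP.degree_gap P hG (by rw [hψ₁W]; exact hWpos) g1 y hy
  -- Stage 3
  have g3 : ψ₃.Gap (min 2 P.η * (r / q₀ * ψ₁.m) / (P.Nx n₂ * P.D)) := P.padExp_gap G₂ C₂ W g2 hNpos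
  -- Stage 4
  have hdH : 0 < P.dH := P.dH_pos
  have hlam := P.padExp_spectral hG G₂ C₂ W
  set ε₃ : ℝ := min 2 P.η * (r / q₀ * ψ₁.m) / (P.Nx n₂ * P.D) with hε₃
  have hmin0 : 0 ≤ min 2 P.η := le_min zero_le_two hG.η_pos.le
  have hDpos : (0 : ℝ) < P.D := by exact_mod_cast P.D_pos
  have hNR : (0 : ℝ) < P.Nx n₂ := by exact_mod_cast hNpos
  have hε₃0 : 0 ≤ ε₃ := by
    rw [hε₃]
    exact div_nonneg (mul_nonneg hmin0 (mul_nonneg (div_nonneg hr0 hqR.le) (Nat.cast_nonneg _))) (mul_nonneg hNR.le hDpos.le)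
  have h4 : 4 * ψ₃.W * P.mw ≤ Nat.sqrt P.t := by
    show 4 * W * (Nat.sqrt P.t / (4 * W)) ≤ Nat.sqrt P.t
    exact Nat.mul_div_le _ _
  have g4 := LazyCSP.powAlpha_gap P ψ₃ hdH hNpos hlam hWpos hG.mw_pos h4 hε₃0 g3 P.k₄
  -- the final estimate: `ε₄/2 ≥ min(2r, ε₀)`
  refine g4.mono ?_
  -- lower bound on `ε₃` from the padding ratio: `ε₃ ≥ c r` with `c = min(2,η)/(q₀ · 2d₁ · cN · 2(1+dX))`
  have hNx := hG.Nx_le n₂ hn₂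
  have hcN := hG.cN_pos
  have hd1 : (0 : ℝ) < P.d₁ := by exact_mod_cast (show 0 < P.d₁ from Nat.succ_pos _)
  have hK : (0 : ℝ) < (q₀ : ℝ) * (2 * P.d₁) * P.cN * (2 * (1 + P.dX)) :=
    mul_pos (mul_pos (mul_pos hqR (mul_pos two_pos hd1)) hcN) (by positivity)
  set c : ℝ := min 2 P.η / ((q₀ : ℝ) * (2 * P.d₁) * P.cN * (2 * (1 + P.dX))) with hc
  have hc0 : 0 ≤ c := div_nonneg hmin0 hK.le
  have hmr : 0 ≤ min 2 P.η * r := mul_nonneg hmin0 hr0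
  have hND : (0 : ℝ) < P.Nx n₂ * P.D := mul_pos hNR hDpos
  have hDeq : ((P.D : ℕ) : ℝ) = 2 * ((P.d₁ : ℕ) : ℝ) * (1 + P.dX) := by
    rw [show P.D = 2 * P.d₁ * (1 + P.dX) from by unfold RoundParams.D RoundParams.dH; ring]
    push_cast; ring
  have hn₂R : (n₂ : ℝ) = φ.cons.length * q₀ * 2 := by rw [hn₂def, hψ₁m]; push_cast; ring
  have hε₃c : c * r ≤ ε₃ := by
    rw [hc, hε₃, hψ₁m, div_mul_eq_mul_div, div_le_div_iff₀ hK hND]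
    push_cast
    rw [show r / (q₀ : ℝ) * (φ.cons.length * q₀) = r * φ.cons.length by field_simp]
    have key : (P.Nx n₂ : ℝ) * P.D ≤ φ.cons.length * ((q₀ : ℝ) * (2 * P.d₁) * P.cN * (2 * (1 + P.dX))) :=
      calc (P.Nx n₂ : ℝ) * P.D ≤ P.cN * n₂ * P.D := mul_le_mul_of_nonneg_right hNx hDpos.le
        _ = _ := by rw [hn₂R, hDeq]; ring
    calc min 2 P.η * r * (P.Nx n₂ * P.D) ≤ min 2 P.η * r * (φ.cons.length * ((q₀ : ℝ) * (2 * P.d₁) * P.cN * (2 * (1 + P.dX)))) :=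
          mul_le_mul_of_nonneg_left key hmr
      _ = min 2 P.η * (r * φ.cons.length) * (q₀ * (2 * P.d₁) * P.cN * (2 * (1 + P.dX))) := by ring
  -- the function `x ↦ mw x / (16 W⁴ (1 + 18 D + 2 mw D² x))` is increasing; evaluate at `min (c r) (1/(2 mw D²))`
  set Dn : ℝ := ((P.dH + P.dH : ℕ) : ℝ) with hDn
  have hDnD : Dn = P.D := rfl
  set Mw : ℝ := (P.mw : ℝ) with hMw
  have hMw1 : 1 ≤ Mw := by rw [hMw]; exact_mod_cast hG.mw_pos
  have hbig := hG.big
  -- abbreviations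
  have hWpos' : (0 : ℝ) < W := lt_of_lt_of_le one_pos hWR
  have hW4 : (0 : ℝ) < 16 * (W : ℝ) ^ 4 := by have := pow_pos hWpos' 4; linarith
  have key : min (2 * r) P.ε₀ ≤ Mw * ε₃ / (16 * (W : ℝ) ^ 4 * (1 + 18 * Dn + 2 * Mw * Dn ^ 2 * ε₃)) / 2 := by
    rw [hDnD]
    have hMw0 : 0 ≤ Mw := by rw [hMw]; exact Nat.cast_nonneg _
    have hx0 : 0 ≤ 2 * Mw * (P.D : ℝ) ^ 2 * ε₃ := mul_nonneg (mul_nonneg (mul_nonneg zero_le_two hMw0) (sq_nonneg _)) hε₃0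
    have h18 : (0 : ℝ) ≤ 18 * P.D := by positivity
    have hden : 0 < 16 * (W : ℝ) ^ 4 * (1 + 18 * P.D + 2 * Mw * (P.D : ℝ) ^ 2 * ε₃) :=
      mul_pos hW4 (by linarith)
    rcases le_or_gt (2 * Mw * (P.D : ℝ) ^ 2 * ε₃) 1 with hsmall | hlarge
    · -- amplification regime: the value is `≥ Mw ε₃/(16W⁴(2+18D))/2 ≥ Mw c r/(32 W⁴ (2+18D)) ≥ 2r`
      refine (min_le_left _ _).trans ?_
      rw [le_div_iff₀ two_pos, le_div_iff₀ hden]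
      have h1 : Mw * (c * r) ≤ Mw * ε₃ := mul_le_mul_of_nonneg_left hε₃c (by linarith)
      -- `hbig : 64 W⁴ (2+18D) (q₀ 2d₁ cN 2(1+dX)) ≤ mw min(2,η)`, i.e. `64 W⁴ (2 + 18 D) ≤ Mw c`
      have hbig' : 64 * (W : ℝ) ^ 4 * (2 + 18 * P.D) ≤ Mw * c := by
        rw [hc, hMw, mul_div_assoc', le_div_iff₀ hK]
        exact hbig
      calc 2 * r * 2 * (16 * (W : ℝ) ^ 4 * (1 + 18 * P.D + 2 * Mw * (P.D : ℝ) ^ 2 * ε₃))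
          ≤ 2 * r * 2 * (16 * (W : ℝ) ^ 4 * (2 + 18 * P.D)) := by
            have hle : (1 + 18 * (P.D : ℝ) + 2 * Mw * (P.D : ℝ) ^ 2 * ε₃) ≤ 2 + 18 * P.D := by linarith
            have hr4 : 0 ≤ 2 * r * 2 := by linarith
            exact mul_le_mul_of_nonneg_left (mul_le_mul_of_nonneg_left hle (by positivity)) hr4
        _ = r * (64 * (W : ℝ) ^ 4 * (2 + 18 * P.D)) := by ring
        _ ≤ r * (Mw * c) := mul_le_mul_of_nonneg_left hbig' hr0
        _ = Mw * (c * r) := by ring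
        _ ≤ Mw * ε₃ := h1
    · -- saturation regime: `ε₃ > 1/(2 Mw D²)`, the value is `≥ ε₀`
      refine (min_le_right _ _).trans ?_
      unfold ε₀
      have hd1 : (0 : ℝ) < 64 * (W : ℝ) ^ 4 * (P.D : ℝ) ^ 2 * (2 + 18 * P.D) :=
        mul_pos (mul_pos (by linarith [hW4]) (pow_pos hDpos 2)) (by positivity)
      rw [div_div, div_le_div_iff₀ hd1 (mul_pos hden two_pos), one_mul]
      -- `16 W⁴ (1 + 18D + 2 Mw D² ε₃) · 2 ≤ Mw ε₃ · 64 W⁴ D² (2 + 18 D)` given `2 Mw D² ε₃ > 1`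
      have hx : 1 < 2 * Mw * (P.D : ℝ) ^ 2 * ε₃ := hlarge
      nlinarith [mul_pos hW4 (by positivity : (0 : ℝ) < 1 + 18 * P.D), hx, hDpos,
        mul_nonneg (mul_nonneg (by positivity : (0 : ℝ) ≤ 16 * (W : ℝ) ^ 4) (by positivity : (0 : ℝ) ≤ (P.D : ℝ) ^ 2)) hε₃0]
  exact key

end RoundParams

end Expander

end Literature.Computability.Complexity

end
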